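import Mathlib
import Summits.Ventures.FusionMHD.Models.FluxSurfacePolarRayLevelLoop
import HarnessLib

/-!
# Polar-ray chart, LEVEL direction (IV): the TOROIDAL CURRENT `I(u) = (1/μ₀)∮ B_p dℓ` (Freidberg (6.27) = Jardin (5.34)) on the glued
# loop as a polar integral, its kernel `G·s/((R_c + s cos θ)·D)`, and `dI/du` from the panels — the last label derivative of (8.134)

LADDER-GRIDFUSION (F2 item R2 / F1 on the Cerfon–Freidberg rung), cell `gridfusion`, seat `gridfusion-model-7` (g5), 2026-08-27.
Fourth file of «F2.R2-POLAR-LEVEL-DERIV» (`Models/FluxSurfacePolarRayLevel{,Kernels,Loop}.lean`).  Jardin's flux-coordinate Mercier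
criterion (8.134) (`Literature/…/MercierFluxForm.lean`, `SurfaceData`) takes the label derivatives `V″`, `Φ″ = 2πq′` (Loop file) AND
`I′` — the derivative of the toroidal current within the surface, `μ₀ I = ∮ B_p dℓ` (Freidberg (6.27); Jardin (5.34)
`I = (Ψ′/2πμ₀)V′⟨|∇ψ|²/R²⟩`, the same number — `FluxSurfaceAverage.toroidalCurrentJ_eq`).  On the polar-ray loop
`dℓ = ρ|∇ψ|/|D_r| dθ` and `B_p = |∇ψ|/R`, so `μ₀ I(u) = ∫₀^{2π} |∇ψ|²(γθ)·ρ/(R·|D_r|) dθ`: the weight is `g = |∇ψ|²` in ★ #88's identity.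
For the DERIVATIVE the weight itself moves with the surface, so this file carries an abstract GRADIENT-SQUARED FIELD `G(θ, s)`
(`= ψ_R² + ψ_Z²` at the ray point; in an instance a code list like `D`) and its ray derivative `G₁ = ∂_s G`.

WHAT IS PROVED ([folklore] calculus; the functional carries its printed source):
* §1 `toroidalCurrentE_eq_polar_rayRadius`: on the glued loop (hypotheses of the Loop file's §1),
  `toroidalCurrentE μ₀ ψ γ (2π) = (1/μ₀) ∫₀^{2π} (ψ_R² + ψ_Z²)(γθ)·ρ(θ)/(R(θ)|D_r(θ)|) dθ`.
* §2 `curKernel R_c D G θ s = G(θ,s)·s/((R_c + s cos θ)·D(θ,s))` (`= G · polarKernel`), `curKernelDs` (its `s`-derivative for supplied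
  `D₁ = ∂_s D`, `G₁ = ∂_s G`), `hasDerivAt_curKernel`, joint continuity; **`LevelPanel.hasDerivAt_curIntegral`** (panel piece of `μ₀ I′`).
* §3 **`LevelLoop.toroidalCurrentE_eq`** (for every admissible `u`: `I(u) = (1/μ₀)∫₀^{2π} curKernel(θ, ρ_u θ) dθ`, given the
  identification `hG : ψ_R² + ψ_Z² = G` on the boxes) and **`LevelLoop.hasDerivAt_toroidalCurrentE`**
  (`HasDerivAt (u ↦ I(u)) ((1/μ₀)∫₀^{2π} curKernelDs/D along ρ_{u₀}) u₀`).
With the Loop file this makes EVERY label-derivative input of (8.134) on an implicit surface (`V″`, `Φ″`, `I′`; `Ψ″ = 0` in the natural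
label, `K′`, `p′` profile data) one θ-integral of an explicit kernel along the glued radius.
MODELLED: nothing.  NOT CLAIMED: any value for any equilibrium; that an instance's `G`, `G₁` are `|∇ψ|²`, `∂_s|∇ψ|²` beyond the
hypothesis `hG` (per-instance closed forms).
-/

noncomputable section

open Real Set Filter Topology MeasureTheory intervalIntegral
open Literature.MathematicalPhysics.MHD.GradShafranov

namespace Summit.Ventures.FusionMHD.Models

namespace PolarRay

/-! ## §1 The toroidal current on the glued loop as a polar integral -/

section loopIdentity

variable {ψ : ℝ → ℝ → ℝ} {Rc Zc u : ℝ}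

/-- **`μ₀ I` ON THE GLUED LOOP AS A POLAR INTEGRAL**: under the hypotheses of the Loop file's §1,
`toroidalCurrentE μ₀ ψ γ (2π) = (1/μ₀)∫₀^{2π} (ψ_R² + ψ_Z²)(γθ)·ρ(θ)/(R(θ)·|D_r(θ)|) dθ` (`B_p = B_p²R²/(R²B_p)` pointwise, then ★ #88's
identity with weight `B_p²R² = ψ_R² + ψ_Z²`). [cite: Freidberg2014, §6.3.3 eq. (6.27)] -/
theorem toroidalCurrentE_eq_polar_rayRadius (μ0 : ℝ) {L : ℝ → (ℝ × ℝ →L[ℝ] ℝ)}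
    (hlev : ∀ θ ∈ Icc 0 (2 * π), rayProfile ψ Rc Zc θ (rayRadius ψ Rc Zc u θ) = u)
    (hcont : ContinuousOn (rayRadius ψ Rc Zc u) (Icc 0 (2 * π)))
    (hρ0 : ∀ θ ∈ uIcc 0 (2 * π), 0 < rayRadius ψ Rc Zc u θ)
    (hψ : ∀ θ ∈ uIcc 0 (2 * π), HasFDerivAt (fun p : ℝ × ℝ => ψ p.1 p.2) (L θ) (loop Rc Zc (rayRadius ψ Rc Zc u) θ))
    (hDr : ∀ θ ∈ uIcc 0 (2 * π), radialDeriv (L θ (1, 0)) (L θ (0, 1)) θ ≠ 0)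
    (hR : ∀ θ ∈ uIcc 0 (2 * π), 0 < (loop Rc Zc (rayRadius ψ Rc Zc u) θ).1) :
    toroidalCurrentE μ0 ψ (loop Rc Zc (rayRadius ψ Rc Zc u)) (2 * π)
      = (1 / μ0) * ∫ θ in (0 : ℝ)..(2 * π), ((L θ (1, 0)) ^ 2 + (L θ (0, 1)) ^ 2)
          * (rayRadius ψ Rc Zc u θ / ((loop Rc Zc (rayRadius ψ Rc Zc u) θ).1 * |radialDeriv (L θ (1, 0)) (L θ (0, 1)) θ|)) := by
  have h := loopIntegralE_eq_polar_rayRadius (fun R Z => fieldBpol ψ R Z ^ 2 * R ^ 2) hlev hcont hρ0 hψ hDr hR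
  unfold toroidalCurrentE
  rw [div_eq_mul_inv, mul_comm, ← one_div]
  congr 1
  -- `B_p = (B_p² R²)/(R² B_p)` along the loop (B_p ≠ 0, R ≠ 0), then ★ #88's identity with the weight `B_p²R² = ψ_R² + ψ_Z²`
  have e1 : loopIntegralE (loop Rc Zc (rayRadius ψ Rc Zc u)) (2 * π) (fieldBpol ψ)
      = loopIntegralE (loop Rc Zc (rayRadius ψ Rc Zc u)) (2 * π)
          (fun R Z => fieldBpol ψ R Z ^ 2 * R ^ 2 / (R ^ 2 * fieldBpol ψ R Z)) := by
    unfold loopIntegralE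
    apply intervalIntegral.integral_congr
    intro θ hθ
    have hR0 : (loop Rc Zc (rayRadius ψ Rc Zc u) θ).1 ≠ 0 := (hR θ hθ).ne'
    have hψ' : HasFDerivAt (fun p : ℝ × ℝ => ψ p.1 p.2) (L θ)
        ((loop Rc Zc (rayRadius ψ Rc Zc u) θ).1, (loop Rc Zc (rayRadius ψ Rc Zc u) θ).2) := hψ θ hθ
    have hB : fieldBpol ψ (loop Rc Zc (rayRadius ψ Rc Zc u) θ).1 (loop Rc Zc (rayRadius ψ Rc Zc u) θ).2 ≠ 0 := by
      rw [fieldBpol_of_hasFDerivAt hψ' hR0]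
      exact div_ne_zero (gradNorm_pos_of_radialDeriv_ne (hDr θ hθ)).ne' (abs_ne_zero.2 hR0)
    simp only
    field_simp
  rw [e1, h]
  apply intervalIntegral.integral_congr
  intro θ hθ
  have hR0 : (loop Rc Zc (rayRadius ψ Rc Zc u) θ).1 ≠ 0 := (hR θ hθ).ne'
  have hψ' : HasFDerivAt (fun p : ℝ × ℝ => ψ p.1 p.2) (L θ)
      ((loop Rc Zc (rayRadius ψ Rc Zc u) θ).1, (loop Rc Zc (rayRadius ψ Rc Zc u) θ).2) := hψ θ hθ
  have hG : 0 ≤ (L θ (1, 0)) ^ 2 + (L θ (0, 1)) ^ 2 := by positivity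
  simp only
  rw [fieldBpol_of_hasFDerivAt hψ' hR0, div_pow, Real.sq_sqrt hG, sq_abs]
  field_simp

end loopIdentity

/-! ## §2 The current kernel and the panel piece of `μ₀ I′` -/

section kernel

variable {Rc : ℝ} {D D₁ G G₁ : ℝ → ℝ → ℝ} {θ s : ℝ}

/-- The CURRENT KERNEL `G(θ,s)·s/((R_c + s cos θ)·D(θ,s))` (`= G · polarKernel`): along the glued radius
`μ₀ I(u) = ∫₀^{2π} curKernel(θ, ρ_u θ) dθ` for `G = |∇ψ|²` at the ray point. [cite: Freidberg2014, §6.3.3 eq. (6.27)] -/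
def curKernel (Rc : ℝ) (D G : ℝ → ℝ → ℝ) (θ s : ℝ) : ℝ := G θ s * polarKernel Rc D θ s

/-- `∂_s curKernel = G₁·polarKernel + G·polarKernelDs` for supplied ray derivatives `D₁ = ∂_s D`, `G₁ = ∂_s G`.
[cite: Freidberg2014, §6.3.3 eq. (6.27)] -/
def curKernelDs (Rc : ℝ) (D D₁ G G₁ : ℝ → ℝ → ℝ) (θ s : ℝ) : ℝ :=
  G₁ θ s * polarKernel Rc D θ s + G θ s * polarKernelDs Rc D D₁ θ s

/-- The `s`-derivative of the current kernel. [folklore] -/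
theorem hasDerivAt_curKernel (hD : HasDerivAt (D θ) (D₁ θ s) s) (hG : HasDerivAt (G θ) (G₁ θ s) s) (hD0 : D θ s ≠ 0)
    (hR : Rc + s * cos θ ≠ 0) : HasDerivAt (curKernel Rc D G θ) (curKernelDs Rc D D₁ G G₁ θ s) s := by
  unfold curKernel curKernelDs
  exact hG.mul (hasDerivAt_polarKernel hD hD0 hR)

/-- Joint continuity of the current kernel. [folklore] -/
theorem continuousOn_curKernel {K : Set (ℝ × ℝ)} (hDc : ContinuousOn (fun p : ℝ × ℝ => D p.1 p.2) K)
    (hGc : ContinuousOn (fun p : ℝ × ℝ => G p.1 p.2) K) (hD0 : ∀ p ∈ K, D p.1 p.2 ≠ 0) (hR : ∀ p ∈ K, Rc + p.2 * cos p.1 ≠ 0) :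
    ContinuousOn (fun p : ℝ × ℝ => curKernel Rc D G p.1 p.2) K := by
  unfold curKernel
  exact hGc.mul (continuousOn_polarKernel hDc hD0 hR)

/-- Joint continuity of its `s`-derivative. [folklore] -/
theorem continuousOn_curKernelDs {K : Set (ℝ × ℝ)} (hDc : ContinuousOn (fun p : ℝ × ℝ => D p.1 p.2) K)
    (hD₁c : ContinuousOn (fun p : ℝ × ℝ => D₁ p.1 p.2) K) (hGc : ContinuousOn (fun p : ℝ × ℝ => G p.1 p.2) K)
    (hG₁c : ContinuousOn (fun p : ℝ × ℝ => G₁ p.1 p.2) K) (hD0 : ∀ p ∈ K, D p.1 p.2 ≠ 0) (hR : ∀ p ∈ K, Rc + p.2 * cos p.1 ≠ 0) :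
    ContinuousOn (fun p : ℝ × ℝ => curKernelDs Rc D D₁ G G₁ p.1 p.2) K := by
  unfold curKernelDs
  exact (hG₁c.mul (continuousOn_polarKernel hDc hD0 hR)).add (hGc.mul (continuousOn_polarKernelDs hDc hD₁c hD0 hR))

end kernel

namespace LevelPanel

variable {ψ : ℝ → ℝ → ℝ} {Rc Zc a b s₁ s₂ uin uout : ℝ} {D D₁ G G₁ : ℝ → ℝ → ℝ}

/-- **THE PANEL PIECE OF `μ₀ I′`.**  Under the panel hypotheses with level margins, `R > 0` on the box, and jointly continuous
`D₁ = ∂_s D`, `G`, `G₁ = ∂_s G`: `d/du|_{u₀} ∫ₐᵇ curKernel(θ, ρ_u θ) dθ = ∫ₐᵇ curKernelDs(θ, ρ_{u₀} θ)/D(θ, ρ_{u₀} θ) dθ`.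
[cite: Jardin2010, §8.5 eq. (8.134)] -/
theorem hasDerivAt_curIntegral (P : LevelPanel ψ Rc Zc a b s₁ s₂ uin uout D) {u₀ : ℝ} (hu₀ : u₀ ∈ Ioo uin uout)
    (hR : ∀ θ ∈ Icc a b, ∀ s ∈ Icc s₁ s₂, 0 < Rc + s * cos θ)
    (hD₁ : ∀ θ ∈ Icc a b, ∀ s ∈ Icc s₁ s₂, HasDerivAt (D θ) (D₁ θ s) s)
    (hD₁c : ContinuousOn (fun p : ℝ × ℝ => D₁ p.1 p.2) (Icc a b ×ˢ Icc s₁ s₂))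
    (hG : ∀ θ ∈ Icc a b, ∀ s ∈ Icc s₁ s₂, HasDerivAt (G θ) (G₁ θ s) s)
    (hGc : ContinuousOn (fun p : ℝ × ℝ => G p.1 p.2) (Icc a b ×ˢ Icc s₁ s₂))
    (hG₁c : ContinuousOn (fun p : ℝ × ℝ => G₁ p.1 p.2) (Icc a b ×ˢ Icc s₁ s₂)) :
    IntervalIntegrable (fun θ => curKernelDs Rc D D₁ G G₁ θ (rayRadius ψ Rc Zc u₀ θ) / D θ (rayRadius ψ Rc Zc u₀ θ)) volume a b ∧
    HasDerivAt (fun u => ∫ θ in a..b, curKernel Rc D G θ (rayRadius ψ Rc Zc u θ))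
      (∫ θ in a..b, curKernelDs Rc D D₁ G G₁ θ (rayRadius ψ Rc Zc u₀ θ) / D θ (rayRadius ψ Rc Zc u₀ θ)) u₀ :=
  have hD0 : ∀ p ∈ Icc a b ×ˢ Icc s₁ s₂, D p.1 p.2 ≠ 0 := fun p hp => (P.slopePos p.1 hp.1 p.2 hp.2).ne'
  have hR0 : ∀ p ∈ Icc a b ×ˢ Icc s₁ s₂, Rc + p.2 * cos p.1 ≠ 0 := fun p hp => (hR p.1 hp.1 p.2 hp.2).ne'
  P.hasDerivAt_integral hu₀
    (fun θ hθ s hs => hasDerivAt_curKernel (hD₁ θ hθ s hs) (hG θ hθ s hs) (hD0 (θ, s) ⟨hθ, hs⟩) (hR0 (θ, s) ⟨hθ, hs⟩))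
    (continuousOn_curKernel P.slopeCont hGc hD0 hR0) (continuousOn_curKernelDs P.slopeCont hD₁c hGc hG₁c hD0 hR0)

end LevelPanel

/-! ## §3 The tree functional `I(u)` on the glued loop, and `dI/du` from the panels -/

namespace LevelLoop

variable {ψ : ℝ → ℝ → ℝ} {Rc Zc uin uout : ℝ} {D D₁ G G₁ : ℝ → ℝ → ℝ} {N : ℕ} {t σ₁ σ₂ : ℕ → ℝ}
  {L : ℝ → ℝ → (ℝ × ℝ →L[ℝ] ℝ)}

/-- **`I(u)` OF THE TREE FUNCTIONAL = `(1/μ₀) ∫₀^{2π} curKernel`** on the glued loop for EVERY admissible level, given the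
identification `ψ_R² + ψ_Z² = G` at the ray points of the boxes. [cite: Freidberg2014, §6.3.3 eq. (6.27)] -/
theorem toroidalCurrentE_eq (Λ : LevelLoop ψ Rc Zc uin uout D N t σ₁ σ₂) (μ0 : ℝ)
    (hψ : ∀ j < N, ∀ θ ∈ Icc (t j) (t (j + 1)), ∀ s ∈ Icc (σ₁ j) (σ₂ j),
      HasFDerivAt (fun p : ℝ × ℝ => ψ p.1 p.2) (L θ s) (rayPoint Rc Zc θ s))
    (hR : ∀ j < N, ∀ θ ∈ Icc (t j) (t (j + 1)), ∀ s ∈ Icc (σ₁ j) (σ₂ j), 0 < Rc + s * cos θ)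
    (hG : ∀ j < N, ∀ θ ∈ Icc (t j) (t (j + 1)), ∀ s ∈ Icc (σ₁ j) (σ₂ j), (L θ s (1, 0)) ^ 2 + (L θ s (0, 1)) ^ 2 = G θ s)
    {u : ℝ} (hu : u ∈ Ioo uin uout) :
    toroidalCurrentE μ0 ψ (loop Rc Zc (rayRadius ψ Rc Zc u)) (2 * π)
      = (1 / μ0) * ∫ θ in (0 : ℝ)..(2 * π), curKernel Rc D G θ (rayRadius ψ Rc Zc u θ) := by
  obtain ⟨hρ0, hψ', hDeq, hDr, hR'⟩ := Λ.loop_hyps hψ hR hu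
  have hlev : ∀ θ ∈ Icc 0 (2 * π), rayProfile ψ Rc Zc θ (rayRadius ψ Rc Zc u θ) = u :=
    fun θ hθ => (Λ.surface_facts hu hθ).1
  have hI : uIcc 0 (2 * π) = Icc 0 (2 * π) := uIcc_of_le two_pi_pos.le
  have hG' : ∀ θ ∈ uIcc 0 (2 * π), (L θ (rayRadius ψ Rc Zc u θ) (1, 0)) ^ 2 + (L θ (rayRadius ψ Rc Zc u θ) (0, 1)) ^ 2
      = G θ (rayRadius ψ Rc Zc u θ) := by
    intro θ hθ
    rw [hI] at hθ
    obtain ⟨j, hj, hθj⟩ := Λ.exists_panel hθ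
    exact hG j hj θ hθj _ (Ioo_subset_Icc_self ((Λ.panel j hj).spec hu hθj).1)
  rw [toroidalCurrentE_eq_polar_rayRadius μ0 hlev (Λ.continuousOn_rayRadius hu) hρ0 hψ' hDr hR']
  congr 1
  apply intervalIntegral.integral_congr
  intro θ hθ
  simp only
  rw [hG' θ hθ, (hDeq θ hθ).1, abs_of_pos (hDeq θ hθ).2]
  rfl

/-- **`dI/du` FROM THE PANELS.**  With jointly continuous `D₁ = ∂_s D`, `G`, `G₁ = ∂_s G` on every box and the identification
`ψ_R² + ψ_Z² = G`: `HasDerivAt (u ↦ toroidalCurrentE μ₀ ψ (loop R_c Z_c ρ_u) (2π)) ((1/μ₀)∫₀^{2π} curKernelDs/D along ρ_{u₀}) u₀` —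
Jardin (8.134)'s `I′` on an IMPLICIT surface, as one θ-integral of an explicit kernel. [cite: Jardin2010, §8.5 eq. (8.134)] -/
theorem hasDerivAt_toroidalCurrentE (Λ : LevelLoop ψ Rc Zc uin uout D N t σ₁ σ₂) (μ0 : ℝ)
    (hψ : ∀ j < N, ∀ θ ∈ Icc (t j) (t (j + 1)), ∀ s ∈ Icc (σ₁ j) (σ₂ j),
      HasFDerivAt (fun p : ℝ × ℝ => ψ p.1 p.2) (L θ s) (rayPoint Rc Zc θ s))
    (hR : ∀ j < N, ∀ θ ∈ Icc (t j) (t (j + 1)), ∀ s ∈ Icc (σ₁ j) (σ₂ j), 0 < Rc + s * cos θ)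
    (hG : ∀ j < N, ∀ θ ∈ Icc (t j) (t (j + 1)), ∀ s ∈ Icc (σ₁ j) (σ₂ j), (L θ s (1, 0)) ^ 2 + (L θ s (0, 1)) ^ 2 = G θ s)
    (hD₁ : ∀ j < N, ∀ θ ∈ Icc (t j) (t (j + 1)), ∀ s ∈ Icc (σ₁ j) (σ₂ j), HasDerivAt (D θ) (D₁ θ s) s)
    (hD₁c : ∀ j < N, ContinuousOn (fun p : ℝ × ℝ => D₁ p.1 p.2) (Icc (t j) (t (j + 1)) ×ˢ Icc (σ₁ j) (σ₂ j)))
    (hG₁ : ∀ j < N, ∀ θ ∈ Icc (t j) (t (j + 1)), ∀ s ∈ Icc (σ₁ j) (σ₂ j), HasDerivAt (G θ) (G₁ θ s) s)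
    (hGc : ∀ j < N, ContinuousOn (fun p : ℝ × ℝ => G p.1 p.2) (Icc (t j) (t (j + 1)) ×ˢ Icc (σ₁ j) (σ₂ j)))
    (hG₁c : ∀ j < N, ContinuousOn (fun p : ℝ × ℝ => G₁ p.1 p.2) (Icc (t j) (t (j + 1)) ×ˢ Icc (σ₁ j) (σ₂ j)))
    {u₀ : ℝ} (hu₀ : u₀ ∈ Ioo uin uout) :
    HasDerivAt (fun u => toroidalCurrentE μ0 ψ (loop Rc Zc (rayRadius ψ Rc Zc u)) (2 * π))
      ((1 / μ0) * ∫ θ in (0 : ℝ)..(2 * π),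
        curKernelDs Rc D D₁ G G₁ θ (rayRadius ψ Rc Zc u₀ θ) / D θ (rayRadius ψ Rc Zc u₀ θ)) u₀ := by
  have hD0 : ∀ j < N, ∀ p ∈ Icc (t j) (t (j + 1)) ×ˢ Icc (σ₁ j) (σ₂ j), D p.1 p.2 ≠ 0 :=
    fun j hj p hp => ((Λ.panel j hj).slopePos p.1 hp.1 p.2 hp.2).ne'
  have hR0 : ∀ j < N, ∀ p ∈ Icc (t j) (t (j + 1)) ×ˢ Icc (σ₁ j) (σ₂ j), Rc + p.2 * cos p.1 ≠ 0 :=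
    fun j hj p hp => (hR j hj p.1 hp.1 p.2 hp.2).ne'
  have h := hasDerivAt_integral_of_adjacent (N := N) (t := t)
    (F := fun u θ => curKernel Rc D G θ (rayRadius ψ Rc Zc u θ))
    (G := fun θ => curKernelDs Rc D D₁ G G₁ θ (rayRadius ψ Rc Zc u₀ θ) / D θ (rayRadius ψ Rc Zc u₀ θ)) (u₀ := u₀)
    (fun j hj => (Λ.panel j hj).eventually_intervalIntegrable_kernel
      (continuousOn_curKernel (Λ.panel j hj).slopeCont (hGc j hj) (hD0 j hj) (hR0 j hj)) hu₀)
    (fun j hj => ((Λ.panel j hj).hasDerivAt_curIntegral hu₀ (hR j hj) (hD₁ j hj) (hD₁c j hj) (hG₁ j hj) (hGc j hj) (hG₁c j hj)).1)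
    (fun j hj => ((Λ.panel j hj).hasDerivAt_curIntegral hu₀ (hR j hj) (hD₁ j hj) (hD₁c j hj) (hG₁ j hj) (hGc j hj) (hG₁c j hj)).2)
  rw [Λ.t_zero, Λ.t_last] at h
  have hev : (fun u => toroidalCurrentE μ0 ψ (loop Rc Zc (rayRadius ψ Rc Zc u)) (2 * π))
      =ᶠ[𝓝 u₀] fun u => (1 / μ0) * ∫ θ in (0 : ℝ)..(2 * π), curKernel Rc D G θ (rayRadius ψ Rc Zc u θ) := by
    filter_upwards [Ioo_mem_nhds hu₀.1 hu₀.2] with u hu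
    exact Λ.toroidalCurrentE_eq μ0 hψ hR hG hu
  exact (h.const_mul (1 / μ0)).congr_of_eventuallyEq hev

end LevelLoop

end PolarRay

end Summit.Ventures.FusionMHD.Models

end
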